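import Summits.Ventures.CertifiedManyBodySolver.Downfold.RectCellEnclosure
import HarnessLib

/-!
# Cell trees with a GENERIC leaf oracle, and the filling certificates of the RECTANGULAR one-band band

Venture CertifiedManyBodySolver, cell `pub/hubbard-downfold` (stage S1, technique B), seat hubbard-downfold-mod-4 (g25);
namespace `Summit.Ventures.CertifiedManyBodySolver.Downfold.Emery`. Everything PROVED; no number lives here. WHAT THIS IS NOT:
a statement about any material; `U = 0` one-body kinematics; the Brillouin-zone fraction is Lebesgue measure.

§1 re-states the `CellTree` checker of `OneBandCellTree` with the two LEAF TESTS abstracted (`CellTree.gcheck yT nT`): the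
structural lemmas (`inside/kept` finsets inside the block, `card = count`) and the two counting theorems hold for ANY occupied
set `Occ ⊆ [0, π]²` once the leaf tests are sound for it (`gInner_le_quadFrac`, `quadFrac_le_gKept`). §2 instantiates them for
the rectangular band `rbBandK H` (`RectBand`) with the leaf enclosure `rbBlockEnclZ` (`RectCellEnclosure`): occupied set
`rbOcc`, filling `rbFilling` (monotone), `rbTreeCheck`, **`inner/K² ≤ rbFilling H e ≤ kept/K²`** and the premise-free
Fermi-energy bracket `rbFermi_mem_Icc_of_treeBracket` (`treeBracketSides` of `OneBandCellTree`).

Sources: subdivision / interval verification [Moore1966, Theorem 3.1, §4.4]; one-band form [AndersenEtAl1995, §6].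
-/

noncomputable section

namespace Summit.Ventures.CertifiedManyBodySolver.Downfold.Emery

open Real Set MeasureTheory

namespace CellTree

/-! ## §1 Generic leaf oracle -/

/-- The tree checker with abstract leaf tests `yT` (block certified INSIDE) / `nT` (block certified OUTSIDE). [folklore] -/
def gcheck (yT nT : Bool → ℕ → ℕ → ℕ → ℕ → Bool) : CellTree → ℕ → ℕ → ℕ → ℕ → Bool
  | o, _, _, _, _ => true
  | y mv, a0, a1, b0, b1 => yT mv a0 a1 b0 b1
  | n mv, a0, a1, b0, b1 => nT mv a0 a1 b0 b1
  | i m l r, a0, a1, b0, b1 =>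
      decide (a0 ≤ m) && decide (m ≤ a1) && l.gcheck yT nT a0 m b0 b1 && r.gcheck yT nT m a1 b0 b1
  | j m l r, a0, a1, b0, b1 =>
      decide (b0 ≤ m) && decide (m ≤ b1) && l.gcheck yT nT a0 a1 b0 m && r.gcheck yT nT a0 a1 m b1

variable {yT nT : Bool → ℕ → ℕ → ℕ → ℕ → Bool}

/-- Inside cells lie in the block. [folklore] -/
theorem gInsideCells_subset : ∀ (t : CellTree) (a0 a1 b0 b1 : ℕ), t.gcheck yT nT a0 a1 b0 b1 = true →
    t.insideCells a0 a1 b0 b1 ⊆ blockCells a0 a1 b0 b1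
  | o, _, _, _, _, _ => by simp [insideCells]
  | y _, _, _, _, _, _ => by simp [insideCells, blockCells]
  | n _, _, _, _, _, _ => by simp [insideCells]
  | i m l r, a0, a1, b0, b1, h => by
      simp only [gcheck, Bool.and_eq_true, decide_eq_true_eq] at h
      obtain ⟨⟨⟨h1, h2⟩, hl⟩, hr⟩ := h
      intro p hp
      simp only [insideCells, Finset.mem_union] at hp
      rw [mem_blockCells]
      rcases hp with hp | hp
      · have := (mem_blockCells.1 (gInsideCells_subset l _ _ _ _ hl hp)); omega
      · have := (mem_blockCells.1 (gInsideCells_subset r _ _ _ _ hr hp)); omega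
  | j m l r, a0, a1, b0, b1, h => by
      simp only [gcheck, Bool.and_eq_true, decide_eq_true_eq] at h
      obtain ⟨⟨⟨h1, h2⟩, hl⟩, hr⟩ := h
      intro p hp
      simp only [insideCells, Finset.mem_union] at hp
      rw [mem_blockCells]
      rcases hp with hp | hp
      · have := (mem_blockCells.1 (gInsideCells_subset l _ _ _ _ hl hp)); omega
      · have := (mem_blockCells.1 (gInsideCells_subset r _ _ _ _ hr hp)); omega

/-- Kept cells lie in the block. [folklore] -/
theorem gKeptCells_subset : ∀ (t : CellTree) (a0 a1 b0 b1 : ℕ), t.gcheck yT nT a0 a1 b0 b1 = true →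
    t.keptCells a0 a1 b0 b1 ⊆ blockCells a0 a1 b0 b1
  | o, _, _, _, _, _ => by simp [keptCells, blockCells]
  | y _, _, _, _, _, _ => by simp [keptCells, blockCells]
  | n _, _, _, _, _, _ => by simp [keptCells]
  | i m l r, a0, a1, b0, b1, h => by
      simp only [gcheck, Bool.and_eq_true, decide_eq_true_eq] at h
      obtain ⟨⟨⟨h1, h2⟩, hl⟩, hr⟩ := h
      intro p hp
      simp only [keptCells, Finset.mem_union] at hp
      rw [mem_blockCells]
      rcases hp with hp | hp
      · have := (mem_blockCells.1 (gKeptCells_subset l _ _ _ _ hl hp)); omega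
      · have := (mem_blockCells.1 (gKeptCells_subset r _ _ _ _ hr hp)); omega
  | j m l r, a0, a1, b0, b1, h => by
      simp only [gcheck, Bool.and_eq_true, decide_eq_true_eq] at h
      obtain ⟨⟨⟨h1, h2⟩, hl⟩, hr⟩ := h
      intro p hp
      simp only [keptCells, Finset.mem_union] at hp
      rw [mem_blockCells]
      rcases hp with hp | hp
      · have := (mem_blockCells.1 (gKeptCells_subset l _ _ _ _ hl hp)); omega
      · have := (mem_blockCells.1 (gKeptCells_subset r _ _ _ _ hr hp)); omega

/-- `card insideCells = inner`. [folklore] -/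
theorem gCard_insideCells : ∀ (t : CellTree) (a0 a1 b0 b1 : ℕ), t.gcheck yT nT a0 a1 b0 b1 = true →
    (t.insideCells a0 a1 b0 b1).card = t.inner a0 a1 b0 b1
  | o, _, _, _, _, _ => by simp [insideCells, inner]
  | y _, a0, a1, b0, b1, _ => by simp [insideCells, inner]
  | n _, _, _, _, _, _ => by simp [insideCells, inner]
  | i m l r, a0, a1, b0, b1, h => by
      simp only [gcheck, Bool.and_eq_true, decide_eq_true_eq] at h
      obtain ⟨⟨⟨h1, h2⟩, hl⟩, hr⟩ := h
      simp only [insideCells, inner]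
      rw [Finset.card_union_of_disjoint, gCard_insideCells l _ _ _ _ hl, gCard_insideCells r _ _ _ _ hr]
      refine Finset.disjoint_left.2 fun {p} hp hp' => ?_
      have a := mem_blockCells.1 (gInsideCells_subset l _ _ _ _ hl hp)
      have b := mem_blockCells.1 (gInsideCells_subset r _ _ _ _ hr hp')
      omega
  | j m l r, a0, a1, b0, b1, h => by
      simp only [gcheck, Bool.and_eq_true, decide_eq_true_eq] at h
      obtain ⟨⟨⟨h1, h2⟩, hl⟩, hr⟩ := h
      simp only [insideCells, inner]
      rw [Finset.card_union_of_disjoint, gCard_insideCells l _ _ _ _ hl, gCard_insideCells r _ _ _ _ hr]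
      refine Finset.disjoint_left.2 fun {p} hp hp' => ?_
      have a := mem_blockCells.1 (gInsideCells_subset l _ _ _ _ hl hp)
      have b := mem_blockCells.1 (gInsideCells_subset r _ _ _ _ hr hp')
      omega

/-- `card keptCells = kept`. [folklore] -/
theorem gCard_keptCells : ∀ (t : CellTree) (a0 a1 b0 b1 : ℕ), t.gcheck yT nT a0 a1 b0 b1 = true →
    (t.keptCells a0 a1 b0 b1).card = t.kept a0 a1 b0 b1
  | o, a0, a1, b0, b1, _ => by simp [keptCells, kept]
  | y _, a0, a1, b0, b1, _ => by simp [keptCells, kept]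
  | n _, _, _, _, _, _ => by simp [keptCells, kept]
  | i m l r, a0, a1, b0, b1, h => by
      simp only [gcheck, Bool.and_eq_true, decide_eq_true_eq] at h
      obtain ⟨⟨⟨h1, h2⟩, hl⟩, hr⟩ := h
      simp only [keptCells, kept]
      rw [Finset.card_union_of_disjoint, gCard_keptCells l _ _ _ _ hl, gCard_keptCells r _ _ _ _ hr]
      refine Finset.disjoint_left.2 fun {p} hp hp' => ?_
      have a := mem_blockCells.1 (gKeptCells_subset l _ _ _ _ hl hp)
      have b := mem_blockCells.1 (gKeptCells_subset r _ _ _ _ hr hp')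
      omega
  | j m l r, a0, a1, b0, b1, h => by
      simp only [gcheck, Bool.and_eq_true, decide_eq_true_eq] at h
      obtain ⟨⟨⟨h1, h2⟩, hl⟩, hr⟩ := h
      simp only [keptCells, kept]
      rw [Finset.card_union_of_disjoint, gCard_keptCells l _ _ _ _ hl, gCard_keptCells r _ _ _ _ hr]
      refine Finset.disjoint_left.2 fun {p} hp hp' => ?_
      have a := mem_blockCells.1 (gKeptCells_subset l _ _ _ _ hl hp)
      have b := mem_blockCells.1 (gKeptCells_subset r _ _ _ _ hr hp')
      omega

variable {K : ℕ} {Occ : Set (ℝ × ℝ)}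

/-- LEAF SOUNDNESS hypotheses of the oracle for an occupied set `Occ`: a passing `yT` puts every momentum of the closed block
(inside the quadrant) in `Occ`, a passing `nT` keeps it out. [folklore] -/
def LeafSound (K : ℕ) (Occ : Set (ℝ × ℝ)) (yT nT : Bool → ℕ → ℕ → ℕ → ℕ → Bool) : Prop :=
  (∀ mv a0 a1 b0 b1, a0 ≤ a1 → b0 ≤ b1 → a1 ≤ K → b1 ≤ K → yT mv a0 a1 b0 b1 = true →
    ∀ k : ℝ × ℝ, gridPt K a0 ≤ k.1 → k.1 ≤ gridPt K a1 → gridPt K b0 ≤ k.2 → k.2 ≤ gridPt K b1 → k ∈ Occ) ∧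
  (∀ mv a0 a1 b0 b1, a0 ≤ a1 → b0 ≤ b1 → a1 ≤ K → b1 ≤ K → nT mv a0 a1 b0 b1 = true →
    ∀ k : ℝ × ℝ, gridPt K a0 ≤ k.1 → k.1 ≤ gridPt K a1 → gridPt K b0 ≤ k.2 → k.2 ≤ gridPt K b1 → k ∉ Occ)

/-- Every certified-inside cell lies in `Occ`. [folklore] -/
theorem gCellIco_subset (hL : LeafSound K Occ yT nT) :
    ∀ (t : CellTree) (a0 a1 b0 b1 : ℕ), a1 ≤ K → b1 ≤ K → t.gcheck yT nT a0 a1 b0 b1 = true →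
    ∀ ij ∈ t.insideCells a0 a1 b0 b1, cellIco K ij ⊆ Occ
  | o, _, _, _, _, _, _, _ => by simp [insideCells]
  | n _, _, _, _, _, _, _, _ => by simp [insideCells]
  | y mv, a0, a1, b0, b1, ha1, hb1, h => by
      intro ij hij k hk
      simp only [insideCells, Finset.mem_product, Finset.mem_Ico] at hij
      obtain ⟨⟨hi0, hi1⟩, ⟨hj0, hj1⟩⟩ := hij
      obtain ⟨⟨h1lo, h1hi⟩, ⟨h2lo, h2hi⟩⟩ := hk
      simp only [gcheck] at h
      exact hL.1 mv a0 a1 b0 b1 (by omega) (by omega) ha1 hb1 h k ((gridPt_mono K hi0).trans h1lo)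
        (h1hi.le.trans (gridPt_mono K (by omega))) ((gridPt_mono K hj0).trans h2lo) (h2hi.le.trans (gridPt_mono K (by omega)))
  | i m l r, a0, a1, b0, b1, ha1, hb1, h => by
      simp only [gcheck, Bool.and_eq_true, decide_eq_true_eq] at h
      obtain ⟨⟨⟨h1, h2⟩, hl⟩, hr⟩ := h
      intro ij hij
      simp only [insideCells, Finset.mem_union] at hij
      rcases hij with hij | hij
      · exact gCellIco_subset hL l a0 m b0 b1 (h2.trans ha1) hb1 hl ij hij
      · exact gCellIco_subset hL r m a1 b0 b1 ha1 hb1 hr ij hij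
  | j m l r, a0, a1, b0, b1, ha1, hb1, h => by
      simp only [gcheck, Bool.and_eq_true, decide_eq_true_eq] at h
      obtain ⟨⟨⟨h1, h2⟩, hl⟩, hr⟩ := h
      intro ij hij
      simp only [insideCells, Finset.mem_union] at hij
      rcases hij with hij | hij
      · exact gCellIco_subset hL l a0 a1 b0 m ha1 (h2.trans hb1) hl ij hij
      · exact gCellIco_subset hL r a0 a1 m b1 ha1 hb1 hr ij hij

/-- Every block cell that is NOT kept misses `Occ` (closed cell). [folklore] -/
theorem gDisjoint (hL : LeafSound K Occ yT nT) :
    ∀ (t : CellTree) (a0 a1 b0 b1 : ℕ), a1 ≤ K → b1 ≤ K → t.gcheck yT nT a0 a1 b0 b1 = true →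
    ∀ p : ℕ × ℕ, p ∈ blockCells a0 a1 b0 b1 → p ∉ t.keptCells a0 a1 b0 b1 → Disjoint (cellIcc K p) Occ
  | o, a0, a1, b0, b1, _, _, _ => by
      intro p hp hnot; simp only [keptCells] at hnot; exact absurd hp hnot
  | y _, a0, a1, b0, b1, _, _, _ => by
      intro p hp hnot; simp only [keptCells] at hnot; exact absurd hp hnot
  | n mv, a0, a1, b0, b1, ha1, hb1, h => by
      intro p hp _
      rw [mem_blockCells] at hp
      obtain ⟨hi0, hi1, hj0, hj1⟩ := hp
      simp only [gcheck] at h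
      rw [Set.disjoint_left]
      rintro k ⟨⟨h1lo, h1hi⟩, ⟨h2lo, h2hi⟩⟩ hocc
      exact hL.2 mv a0 a1 b0 b1 (by omega) (by omega) ha1 hb1 h k ((gridPt_mono K hi0).trans h1lo)
        (h1hi.trans (gridPt_mono K (by omega))) ((gridPt_mono K hj0).trans h2lo) (h2hi.trans (gridPt_mono K (by omega))) hocc
  | i m l r, a0, a1, b0, b1, ha1, hb1, h => by
      simp only [gcheck, Bool.and_eq_true, decide_eq_true_eq] at h
      obtain ⟨⟨⟨h1, h2⟩, hl⟩, hr⟩ := h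
      intro p hp hnot
      simp only [keptCells, Finset.mem_union, not_or] at hnot
      rw [mem_blockCells] at hp
      by_cases hpm : p.1 < m
      · exact gDisjoint hL l a0 m b0 b1 (h2.trans ha1) hb1 hl p (mem_blockCells.2 (by omega)) hnot.1
      · exact gDisjoint hL r m a1 b0 b1 ha1 hb1 hr p (mem_blockCells.2 (by omega)) hnot.2
  | j m l r, a0, a1, b0, b1, ha1, hb1, h => by
      simp only [gcheck, Bool.and_eq_true, decide_eq_true_eq] at h
      obtain ⟨⟨⟨h1, h2⟩, hl⟩, hr⟩ := h
      intro p hp hnot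
      simp only [keptCells, Finset.mem_union, not_or] at hnot
      rw [mem_blockCells] at hp
      by_cases hpm : p.2 < m
      · exact gDisjoint hL l a0 a1 b0 m ha1 (h2.trans hb1) hl p (mem_blockCells.2 (by omega)) hnot.1
      · exact gDisjoint hL r a0 a1 m b1 ha1 hb1 hr p (mem_blockCells.2 (by omega)) hnot.2

/-- **GENERIC INNER BOUND**: `inner/K² ≤ quadFrac Occ`. [folklore] -/
theorem gInner_le_quadFrac (hK : 0 < K) (hOcc : Occ ⊆ quadrant) (hL : LeafSound K Occ yT nT) {t : CellTree}
    (h : t.gcheck yT nT 0 K 0 K = true) : ((t.inner 0 K 0 K : ℕ) : ℝ) / (K : ℝ) ^ 2 ≤ quadFrac Occ := by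
  have := card_div_sq_le_quadFrac hK hOcc (t.insideCells 0 K 0 K) (gCellIco_subset hL t 0 K 0 K le_rfl le_rfl h)
  rw [gCard_insideCells t 0 K 0 K h] at this
  exact this

/-- **GENERIC OUTER BOUND**: `quadFrac Occ ≤ kept/K²`. [folklore] -/
theorem quadFrac_le_gKept (hK : 0 < K) (hOcc : Occ ⊆ quadrant) (hL : LeafSound K Occ yT nT) {t : CellTree}
    (h : t.gcheck yT nT 0 K 0 K = true) : quadFrac Occ ≤ ((t.kept 0 K 0 K : ℕ) : ℝ) / (K : ℝ) ^ 2 := by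
  have := quadFrac_le_card_div_sq hK hOcc (t.keptCells 0 K 0 K) (fun i j hi hj hnot =>
    gDisjoint hL t 0 K 0 K le_rfl le_rfl h (i, j) (mem_blockCells.2 ⟨Nat.zero_le _, hi, Nat.zero_le _, hj⟩) hnot)
  rw [gCard_keptCells t 0 K 0 K h] at this
  exact this

end CellTree

/-! ## §2 The rectangular band: occupied set, filling, tree check, Fermi bracket -/

/-- The occupied part of the quadrant of the rectangular band at Fermi energy `ε`. [folklore] -/
def rbOcc (H : List (ℕ × ℕ × ℚ)) (ε : ℝ) : Set (ℝ × ℝ) := {k | k ∈ quadrant ∧ rbBandK H k.1 k.2 ≤ ε}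

/-- THE FILLING (per spin) of the rectangular band at Fermi energy `ε`. [folklore] -/
def rbFilling (H : List (ℕ × ℕ × ℚ)) (ε : ℝ) : ℝ := quadFrac (rbOcc H ε)

/-- [folklore] -/
theorem rbOcc_subset (H : List (ℕ × ℕ × ℚ)) (ε : ℝ) : rbOcc H ε ⊆ quadrant := fun _ hk => hk.1

/-- The filling is monotone in the energy. [folklore] -/
theorem rbFilling_monotone (H : List (ℕ × ℕ × ℚ)) : Monotone (rbFilling H) := by
  intro ε₁ ε₂ h; exact quadFrac_mono (fun k hk => ⟨hk.1, hk.2.trans h⟩) (rbOcc_subset H ε₂)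

/-- Leaf tests of the rectangular band at energy `e`. [folklore] -/
def rbLeafY (K : ℕ) (cl ch : ℕ → ℤ) (H : List (ℕ × ℕ × ℚ)) (e : ℚ) (mv : Bool) (a0 a1 b0 b1 : ℕ) : Bool :=
  decide (((rbBlockEnclZ K cl ch H mv a0 a1 b0 b1).2 : ℚ) ≤ e * cellScaleQ K)

/-- [folklore] -/
def rbLeafN (K : ℕ) (cl ch : ℕ → ℤ) (H : List (ℕ × ℕ × ℚ)) (e : ℚ) (mv : Bool) (a0 a1 b0 b1 : ℕ) : Bool :=
  decide (e * cellScaleQ K < ((rbBlockEnclZ K cl ch H mv a0 a1 b0 b1).1 : ℚ))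

/-- TREE CHECK of the rectangular band at energy `e` on the whole quadrant. [folklore] -/
def rbTreeCheck (K : ℕ) (cl ch : ℕ → ℤ) (H : List (ℕ × ℕ × ℚ)) (e : ℚ) (t : CellTree) : Bool :=
  hZOK H && t.gcheck (rbLeafY K cl ch H e) (rbLeafN K cl ch H e) 0 K 0 K

/-- The rectangular leaf tests are sound. [cite: Moore1966, Theorem 3.1, §4.4] -/
theorem rbLeafSound {K : ℕ} (hK : 0 < K) (hev : K % 2 = 0) {cl ch : ℕ → ℤ} (hT : CosEnclZ K cl ch)
    {H : List (ℕ × ℕ × ℚ)} (hz : hZOK H = true) (e : ℚ) :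
    CellTree.LeafSound K (rbOcc H e) (rbLeafY K cl ch H e) (rbLeafN K cl ch H e) := by
  have hsc := cellScale_pos hK
  constructor
  · intro mv a0 a1 b0 b1 ha hb ha1 hb1 h k hx1 hx2 hy1 hy2
    have henc := (rbBlockEnclZ_sound hK hev hT hz mv ha hb hx1 hx2 hy1 hy2).2
    unfold rbLeafY at h
    have h' := (Rat.cast_le (K := ℝ)).2 (of_decide_eq_true h)
    push_cast at h'; rw [cast_cellScaleQ] at h'
    refine ⟨⟨⟨(gridPt_nonneg K _).trans hx1, hx2.trans (gridPt_le_pi hK ha1)⟩,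
      ⟨(gridPt_nonneg K _).trans hy1, hy2.trans (gridPt_le_pi hK hb1)⟩⟩, ?_⟩
    show rbBandK H k.1 k.2 ≤ e
    nlinarith
  · intro mv a0 a1 b0 b1 ha hb ha1 hb1 h k hx1 hx2 hy1 hy2 hocc
    have henc := (rbBlockEnclZ_sound hK hev hT hz mv ha hb hx1 hx2 hy1 hy2).1
    unfold rbLeafN at h
    have h' := (Rat.cast_lt (K := ℝ)).2 (of_decide_eq_true h)
    push_cast at h'; rw [cast_cellScaleQ] at h'
    have hle : rbBandK H k.1 k.2 ≤ e := hocc.2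
    nlinarith

/-- **The filling of the rectangular band at a rational energy is enclosed by the two counts of a checked tree.** [folklore] -/
theorem rbFilling_mem_of_treeCheck {K : ℕ} (hK : 0 < K) (hev : K % 2 = 0) {cl ch : ℕ → ℤ} (hT : CosEnclZ K cl ch)
    {H : List (ℕ × ℕ × ℚ)} {e : ℚ} {t : CellTree} (h : rbTreeCheck K cl ch H e t = true) :
    rbFilling H e ∈ Icc (((t.inner 0 K 0 K : ℕ) : ℝ) / (K : ℝ) ^ 2) (((t.kept 0 K 0 K : ℕ) : ℝ) / (K : ℝ) ^ 2) := by
  simp only [rbTreeCheck, Bool.and_eq_true] at h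
  exact ⟨CellTree.gInner_le_quadFrac hK (rbOcc_subset H e) (rbLeafSound hK hev hT h.1 e) h.2,
    CellTree.quadFrac_le_gKept hK (rbOcc_subset H e) (rbLeafSound hK hev hT h.1 e) h.2⟩

/-- **THE FERMI-ENERGY BRACKET of the rectangular band (premise-free).** [folklore] -/
theorem rbFermi_mem_Icc_of_treeBracket {K : ℕ} (hK : 0 < K) (hev : K % 2 = 0) {cl ch : ℕ → ℤ} (hT : CosEnclZ K cl ch)
    {H : List (ℕ × ℕ × ℚ)} {e₁ e₂ ν₁ ν₂ : ℚ} {t₁ t₂ : CellTree}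
    (h₁ : rbTreeCheck K cl ch H e₁ t₁ = true) (h₂ : rbTreeCheck K cl ch H e₂ t₂ = true)
    (hs : treeBracketSides K e₁ e₂ ν₁ ν₂ (t₁.kept 0 K 0 K) (t₂.inner 0 K 0 K) = true)
    {ε : ℝ} (hν : rbFilling H ε ∈ Icc (ν₁ : ℝ) ν₂) : ε ∈ Icc (e₁ : ℝ) e₂ := by
  simp only [treeBracketSides, Bool.and_eq_true, decide_eq_true_eq] at hs
  obtain ⟨⟨-, hso⟩, hsi⟩ := hs
  have hKr : (0 : ℝ) < K := by exact_mod_cast hK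
  have hout := (rbFilling_mem_of_treeCheck hK hev hT h₁).2
  have hin := (rbFilling_mem_of_treeCheck hK hev hT h₂).1
  have hso' : ((t₁.kept 0 K 0 K : ℕ) : ℝ) / (K : ℝ) ^ 2 < (ν₁ : ℝ) := by
    rw [div_lt_iff₀ (by positivity)]
    have := (Rat.cast_lt (K := ℝ)).2 hso
    push_cast at this ⊢; exact this
  have hsi' : (ν₂ : ℝ) < ((t₂.inner 0 K 0 K : ℕ) : ℝ) / (K : ℝ) ^ 2 := by
    rw [lt_div_iff₀ (by positivity)]
    have := (Rat.cast_lt (K := ℝ)).2 hsi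
    push_cast at this ⊢; exact this
  exact mem_Icc_of_monotone_bracket (rbFilling_monotone H) hout hso' hin hsi' hν

/-- Fillings at X = (π, 0) and Y = (0, π) (exact rational energies) from one checked tree each. [folklore] -/
theorem rbX_filling_of_tree {H : List (ℕ × ℕ × ℚ)} (hH : shellsOK H = true) {t : CellTree}
    (h : rbTreeCheck 384 cosLo384T.get cosHi384T.get H (rbBandQ H (-1) 1) t = true) :
    rbFilling H (rbBandK H π 0) ∈ Icc (((t.inner 0 384 0 384 : ℕ) : ℝ) / ((384 : ℕ) : ℝ) ^ 2)
      (((t.kept 0 384 0 384 : ℕ) : ℝ) / ((384 : ℕ) : ℝ) ^ 2) := by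
  rw [rbBandK_X hH]; exact rbFilling_mem_of_treeCheck (by norm_num) (by norm_num) cosEncl384 h

/-- [folklore] -/
theorem rbY_filling_of_tree {H : List (ℕ × ℕ × ℚ)} (hH : shellsOK H = true) {t : CellTree}
    (h : rbTreeCheck 384 cosLo384T.get cosHi384T.get H (rbBandQ H 1 (-1)) t = true) :
    rbFilling H (rbBandK H 0 π) ∈ Icc (((t.inner 0 384 0 384 : ℕ) : ℝ) / ((384 : ℕ) : ℝ) ^ 2)
      (((t.kept 0 384 0 384 : ℕ) : ℝ) / ((384 : ℕ) : ℝ) ^ 2) := by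
  rw [rbBandK_Y hH]; exact rbFilling_mem_of_treeCheck (by norm_num) (by norm_num) cosEncl384 h

end Summit.Ventures.CertifiedManyBodySolver.Downfold.Emery
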